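import Literature.GroupTheory.CombinatorialGroupTheory.ReidemeisterSchreierCovering
import Mathlib.Data.Fintype.Card
import HarnessLib

/-!
# A breadth-first Schreier tree of a transitive action

Topic `Literature/GroupTheory/CombinatorialGroupTheory`; continues `ReidemeisterSchreierCovering.lean`.
For a TRANSITIVE action `act : F(X) → Sym(A)` with base point `a₀` we construct a Schreier tree
(`SchreierTree`, the datum consumed by the covering presentation
`subgroupEquivCoveringPresentation`) by breadth-first search: `dist a` is the length of a shortest
word carrying `a₀` to `a`; for `a ≠ a₀` a shortest word is `β · L'` and we put
`parent a := L' · a₀` (one step closer to `a₀`), `step a := β`, `arrow a :=` the edge of the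
coset graph between `parent a` and `a` traversed by `β`.  Then (ZVC 2.2.2, "Schreier system of
representatives"; Lyndon–Schupp II.4 proof of 4.1):

* `bfsTransversal` — `t a = step a · t (parent a)`, `t a₀ = 1`, with `t a · a₀ = a`;
* `bfsTree : SchreierTree act a₀` — the tree edges are the `arrow a`, `a ≠ a₀`;
* `arrow_injOn`, `card_bfsEdges` — distinct non-base vertices have distinct tree edges, so there
  are exactly `|A| - 1` of them (a spanning tree of the coset graph);
* `ends_arrow` — the edge `arrow a` joins `parent a` and `a`; `dist_parent_lt` — `parent a` is
  strictly closer to the base point (so processing vertices by increasing `dist` processes parents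
  first: the contraction order of `TreeContraction.lean`).

## References

* H. Zieschang, E. Vogt, H.-D. Coldewey, *Surfaces and Planar Discontinuous Groups*, LNM 835,
  Springer 1980, 2.2.2. [ZieschangVogtColdewey1980]
-/

namespace Literature.GroupTheory.CombinatorialGroupTheory

namespace CoveringPresentation

universe u v

variable {X : Type u} {A : Type v} (act : FreeGroup X →* Equiv.Perm A) (a₀ : A)

/-- The action is transitive from `a₀`: every point is `L · a₀` for some word `L`.
[cite: ZieschangVogtColdewey1980, 2.2.2] -/
def IsTransitiveFrom : Prop := ∀ a : A, ∃ L : List (X × Bool), act (FreeGroup.mk L) a₀ = a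

variable {act a₀} (htr : IsTransitiveFrom act a₀)
include htr

/-- There is a word of some length carrying `a₀` to `a`. [cite: ZieschangVogtColdewey1980, 2.2.2] -/
theorem exists_length_word (a : A) : ∃ n, ∃ L : List (X × Bool), L.length = n ∧ act (FreeGroup.mk L) a₀ = a := by
  obtain ⟨L, hL⟩ := htr a
  exact ⟨L.length, L, rfl, hL⟩

open Classical in
/-- **Distance from the base point** in the coset graph: the length of a shortest word carrying
`a₀` to `a`. [cite: ZieschangVogtColdewey1980, 2.2.2] -/
noncomputable def dist (a : A) : ℕ := Nat.find (exists_length_word htr a)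

open Classical in
/-- A shortest word carrying `a₀` to `a`. [cite: ZieschangVogtColdewey1980, 2.2.2] -/
noncomputable def geodesic (a : A) : List (X × Bool) := Classical.choose (Nat.find_spec (exists_length_word htr a))

open Classical in
/-- The geodesic has length `dist a`. [cite: ZieschangVogtColdewey1980, 2.2.2] -/
theorem length_geodesic (a : A) : (geodesic htr a).length = dist htr a :=
  (Classical.choose_spec (Nat.find_spec (exists_length_word htr a))).1

open Classical in
/-- The geodesic carries `a₀` to `a`. [cite: ZieschangVogtColdewey1980, 2.2.2] -/
theorem act_geodesic (a : A) : act (FreeGroup.mk (geodesic htr a)) a₀ = a :=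
  (Classical.choose_spec (Nat.find_spec (exists_length_word htr a))).2

open Classical in
/-- No shorter word carries `a₀` to `a`. [cite: ZieschangVogtColdewey1980, 2.2.2] -/
theorem dist_le_length {a : A} {L : List (X × Bool)} (hL : act (FreeGroup.mk L) a₀ = a) :
    dist htr a ≤ L.length :=
  Nat.find_min' (exists_length_word htr a) ⟨L, rfl, hL⟩

/-- Only the base point is at distance `0`. [cite: ZieschangVogtColdewey1980, 2.2.2] -/
theorem dist_eq_zero_iff (a : A) : dist htr a = 0 ↔ a = a₀ := by
  constructor
  · intro h
    have hl := length_geodesic htr a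
    rw [h, List.length_eq_zero_iff] at hl
    have := act_geodesic htr a
    rw [hl, show FreeGroup.mk ([] : List (X × Bool)) = 1 from rfl, map_one, Equiv.Perm.one_apply] at this
    exact this.symm
  · rintro rfl
    exact Nat.le_zero.1 (dist_le_length htr (L := [])
      (by rw [show FreeGroup.mk ([] : List (X × Bool)) = 1 from rfl, map_one, Equiv.Perm.one_apply]))

/-- The geodesic to a non-base point is nonempty. [cite: ZieschangVogtColdewey1980, 2.2.2] -/
theorem geodesic_ne_nil {a : A} (ha : a ≠ a₀) : geodesic htr a ≠ [] := fun h => by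
  have := length_geodesic htr a
  rw [h, List.length_nil, eq_comm, dist_eq_zero_iff] at this
  exact ha this

/-- **The last step** of the geodesic to `a ≠ a₀` (the generator letter between `parent a` and
`a`). [cite: ZieschangVogtColdewey1980, 2.2.2] -/
noncomputable def step {a : A} (ha : a ≠ a₀) : X × Bool := (geodesic htr a).head (geodesic_ne_nil htr ha)

/-- **The parent** of `a ≠ a₀` in the breadth-first tree: the point reached by the geodesic
without its last step. [cite: ZieschangVogtColdewey1980, 2.2.2] -/
noncomputable def parent (a : A) : A := act (FreeGroup.mk (geodesic htr a).tail) a₀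

/-- The last step carries the parent to the point. [cite: ZieschangVogtColdewey1980, 2.2.2] -/
theorem act_step_parent {a : A} (ha : a ≠ a₀) :
    act (FreeGroup.mk [step htr ha]) (parent htr a) = a := by
  rw [parent, step, ← Equiv.Perm.mul_apply, ← map_mul, FreeGroup.mul_mk, List.singleton_append,
    List.cons_head_tail, act_geodesic]

/-- The parent is strictly closer to the base point. [cite: ZieschangVogtColdewey1980, 2.2.2] -/
theorem dist_parent_lt {a : A} (ha : a ≠ a₀) : dist htr (parent htr a) < dist htr a := by
  have h := dist_le_length htr (a := parent htr a) (L := (geodesic htr a).tail) rfl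
  rw [List.length_tail, length_geodesic] at h
  have : 0 < dist htr a := Nat.pos_of_ne_zero fun h0 => ha ((dist_eq_zero_iff htr a).1 h0)
  omega

open Classical in
/-- **The breadth-first transversal**: `t a₀ = 1`, `t a = step a · t (parent a)`.
[cite: ZieschangVogtColdewey1980, 2.2.2] -/
noncomputable def bfsTransversal (a : A) : FreeGroup X :=
  if ha : a = a₀ then 1 else FreeGroup.mk [step htr ha] * bfsTransversal (parent htr a)
termination_by dist htr a
decreasing_by exact dist_parent_lt htr ha

/-- The transversal at the base point. [cite: ZieschangVogtColdewey1980, 2.2.2] -/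
theorem bfsTransversal_root : bfsTransversal htr a₀ = 1 := by
  rw [bfsTransversal, dif_pos rfl]

/-- The transversal at a non-base point. [cite: ZieschangVogtColdewey1980, 2.2.2] -/
theorem bfsTransversal_of_ne {a : A} (ha : a ≠ a₀) :
    bfsTransversal htr a = FreeGroup.mk [step htr ha] * bfsTransversal htr (parent htr a) := by
  rw [bfsTransversal, dif_neg ha]

/-- The transversal carries the base point to the point. [cite: ZieschangVogtColdewey1980, 2.2.2] -/
theorem act_bfsTransversal (a : A) : act (bfsTransversal htr a) a₀ = a := by
  induction a using (measure (dist htr)).wf.induction with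
  | h a ih =>
    by_cases ha : a = a₀
    · rw [ha, bfsTransversal_root, map_one, Equiv.Perm.one_apply]
    · rw [bfsTransversal_of_ne htr ha, map_mul, Equiv.Perm.mul_apply, ih _ (dist_parent_lt htr ha),
        act_step_parent]

/-- **The tree edge of `a ≠ a₀`**: the edge of the coset graph traversed by the last step of the
geodesic (`(x, parent a)` for a step `x`, `(x, a)` for a step `x⁻¹`).
[cite: ZieschangVogtColdewey1980, 2.2.2] -/
noncomputable def arrow {a : A} (ha : a ≠ a₀) : X × A :=
  if (step htr ha).2 = true then ((step htr ha).1, parent htr a) else ((step htr ha).1, a)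

/-- **The two ends of the tree edge of `a` are `parent a` and `a`.**  Stated with the action:
for `arrow a = (x, c)` either `c = parent a` and `x · c = a` (step `x`), or `c = a` and
`x · c = parent a` (step `x⁻¹`). [cite: ZieschangVogtColdewey1980, 2.2.2] -/
theorem ends_arrow {a : A} (ha : a ≠ a₀) :
    ((arrow htr ha).2 = parent htr a ∧ act (FreeGroup.of (arrow htr ha).1) (arrow htr ha).2 = a ∧
        step htr ha = ((arrow htr ha).1, true)) ∨
      ((arrow htr ha).2 = a ∧ act (FreeGroup.of (arrow htr ha).1) (arrow htr ha).2 = parent htr a ∧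
        step htr ha = ((arrow htr ha).1, false)) := by
  have hs := act_step_parent htr ha
  rcases hβ : step htr ha with ⟨x, s⟩
  rw [hβ] at hs
  cases s
  · right
    rw [arrow, hβ]
    simp only [Bool.false_eq_true, ↓reduceIte, true_and]
    refine ⟨?_, trivial⟩
    have e : FreeGroup.mk [(x, false)] = (FreeGroup.of x)⁻¹ := rfl
    rw [e, map_inv, Equiv.Perm.inv_eq_iff_eq] at hs
    exact hs.symm
  · left
    rw [arrow, hβ]
    simp only [↓reduceIte, true_and]
    exact ⟨hs, trivial⟩

/-- The tree edges. [cite: ZieschangVogtColdewey1980, 2.2.2] -/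
def bfsEdges : Set (X × A) := {e | ∃ (a : A) (ha : a ≠ a₀), e = arrow htr ha}

/-- Along a tree edge the transversal grows by the generator. [cite: ZieschangVogtColdewey1980, 2.2.2] -/
theorem bfsTransversal_edge {a : A} (ha : a ≠ a₀) :
    bfsTransversal htr (act (FreeGroup.of (arrow htr ha).1) (arrow htr ha).2) =
      FreeGroup.of (arrow htr ha).1 * bfsTransversal htr (arrow htr ha).2 := by
  rcases ends_arrow htr ha with ⟨h2, hact, hst⟩ | ⟨h2, hact, hst⟩
  · rw [hact, bfsTransversal_of_ne htr ha, hst, h2]; rfl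
  · rw [hact, h2, bfsTransversal_of_ne htr ha, hst]
    have e : FreeGroup.mk [((arrow htr ha).1, false)] = (FreeGroup.of (arrow htr ha).1)⁻¹ := rfl
    rw [e, mul_inv_cancel_left]

/-- The path word of the transversal of `a` (ending at `a`) is a product of tree edges.
[cite: ZieschangVogtColdewey1980, 2.2.2] -/
theorem pathWord_bfsTransversal_mem (a : A) :
    pathWord act (bfsTransversal htr a) a ∈ Subgroup.closure (FreeGroup.of '' bfsEdges htr) := by
  induction a using (measure (dist htr)).wf.induction with
  | h a ih =>
    by_cases ha : a = a₀
    · rw [ha, bfsTransversal_root, pathWord_one]; exact one_mem _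
    · rw [bfsTransversal_of_ne htr ha, pathWord_mul]
      have hpar : act (FreeGroup.mk [step htr ha])⁻¹ a = parent htr a := by
        rw [map_inv, Equiv.Perm.inv_eq_iff_eq, act_step_parent]
      rw [hpar]
      refine mul_mem ?_ (ih _ (dist_parent_lt htr ha))
      have hmem : FreeGroup.of (arrow htr ha) ∈ Subgroup.closure (FreeGroup.of '' bfsEdges htr) :=
        Subgroup.subset_closure ⟨_, ⟨a, ha, rfl⟩, rfl⟩
      rcases ends_arrow htr ha with ⟨h2, hact, hst⟩ | ⟨h2, hact, hst⟩
      · rw [hst, show FreeGroup.mk [((arrow htr ha).1, true)] = FreeGroup.of (arrow htr ha).1 from rfl,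
          pathWord_of, map_inv, Equiv.Perm.inv_eq_iff_eq.2 hact.symm]
        convert hmem using 2
      · rw [hst, show FreeGroup.mk [((arrow htr ha).1, false)] = (FreeGroup.of (arrow htr ha).1)⁻¹ from rfl,
          pathWord_inv, pathWord_of, map_inv]
        refine inv_mem ?_
        rw [show (act (FreeGroup.of (arrow htr ha).1))⁻¹ ((act (FreeGroup.of (arrow htr ha).1)) a) = a from
          (act _).symm_apply_apply a]
        convert hmem using 2
        exact Prod.ext rfl h2.symm

/-- **The breadth-first Schreier tree** of a transitive action.
[cite: ZieschangVogtColdewey1980, 2.2.2] -/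
noncomputable def bfsTree : SchreierTree act a₀ where
  t := bfsTransversal htr
  t_root := bfsTransversal_root htr
  t_apply := act_bfsTransversal htr
  edges := bfsEdges htr
  t_edge := by
    rintro e ⟨a, ha, rfl⟩
    exact bfsTransversal_edge htr ha
  pathWord_t_mem := pathWord_bfsTransversal_mem htr

/-- **Distinct vertices have distinct tree edges.** [cite: ZieschangVogtColdewey1980, 2.2.2] -/
theorem arrow_injective {a b : A} (ha : a ≠ a₀) (hb : b ≠ a₀) (h : arrow htr ha = arrow htr hb) : a = b := by
  rcases ends_arrow htr ha with ⟨ha2, haa, -⟩ | ⟨ha2, haa, -⟩ <;>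
    rcases ends_arrow htr hb with ⟨hb2, hbb, -⟩ | ⟨hb2, hbb, -⟩
  · rw [← haa, ← hbb, h]
  · -- `a`'s edge is (x, parent a) = (x, b)` and `x · b = parent b`: then `a = parent b`, `b = parent a`
    exfalso
    have h1 : b = parent htr a := by rw [← hb2, ← h, ha2]
    have h2 : a = parent htr b := by rw [← haa, h, hbb]
    have := dist_parent_lt htr ha
    have := dist_parent_lt htr hb
    rw [← h1] at *; rw [← h2] at *
    omega
  · exfalso
    have h1 : a = parent htr b := by rw [← hb2, ← h, ha2]
    have h2 : b = parent htr a := by rw [← hbb, ← h, haa]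
    have := dist_parent_lt htr ha
    have := dist_parent_lt htr hb
    rw [← h1] at *; rw [← h2] at *
    omega
  · rw [← ha2, ← hb2, h]

end CoveringPresentation

end Literature.GroupTheory.CombinatorialGroupTheory
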